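import Summits.CriticalPhenomena.PercolationContinuityZ3.Theorems.PercNearOneGluingNoHeavyLowerTailSunflowerLinkedCurrency
import HarnessLib

/-!
# `NoHeavyLowerTail` (crux stmt-CriticalPhenomena-4575), abstract sunflower cubic: the CHEBYSHEV REDUCTION of the
# two-linked-systems inequality (RES0′) with a FREE (unlinked) second currency to a four-aggregate inequality

Support file (seat `prim-ineq-prove-1` gen 53; `--supports stmt-CriticalPhenomena-4575`).  No `sorry`, no named facts,
Mathlib only.  Memo: run/shared/lean/prim/prim-ineq-prove-1/FINDING-CHEBYSHEV-prove1-g53.md §3.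

CONTEXT.  `…SunflowerLinkedCurrency` proves (RES0′) — the `z₂`-slice of the leaf-leaf edge conjecture as a section
relaxation — for every number of petals when every petal's `H`-excess `b_j` is LINKED to its `Ȳ`-excess `a_j`
(`τ b_j ≤ (1−τ) a_j`; "no voluntary `h`").  With the top cell `h` free, some petals violate the link (pure `h`-petals have
`a_j = 0 < b_j`), and no one-currency/linked argument applies: the pair {`Ȳ`-hub, `h`-petal} is ANTI-aligned.

THIS FILE isolates exactly what is left.  On the two-point space `{Y, H}` with `P(Y) = τ` a petal is the function
`(1 + a_j/τ, 1 + b_j/(1−τ))`, whose mean is its value `1 + a_j + b_j`.  Petals with `τ b_j ≤ (1−τ) a_j` ("`Ȳ`-heavy") are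
pairwise comonotone, and so are the others ("`H`-heavy"); Chebyshev's inequality inside each class is `linked_caps`
(for the `H`-heavy class with the two coordinates swapped).  Hence, with `CB(F) := τ ∏_F (1 + a_j/τ) + (1−τ) ∏_F (1 + b_j/(1−τ))`:

* **`prod_le_cb_mul_cb`** — for ANY finite family with `a_j, b_j ≥ 0`:
  `∏_S (1 + a_j + b_j) ≤ CB(Ȳ-heavy part) · CB(H-heavy part)`.
* **`cb_le_of_faces`** — a single comonotone class is harmless: if `0 < ε_Y ≤ τ`, `0 < ε_H ≤ 1−τ` and the two face budgets
  `ε_Y(∏(1 + a_j/ε_Y) − 1) ≤ A`, `ε_H(∏(1 + b_j/ε_H) − 1) ≤ B` hold on `F`, then `CB(F) ≤ 1 + A + B` (one-coin monotonicity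
  `rfun_anti` on each face).  In particular (RES0′) holds for every family that is entirely `Ȳ`-heavy or entirely `H`-heavy
  (`prod_le_of_faces_of_linked`, `prod_le_of_faces_of_colinked`).
* **`tb10_iff`** — the remaining FOUR-AGGREGATE inequality `(τP₁ + (1−τ)Q₁)(τP₂ + (1−τ)Q₂) ≤ τX + (1−τ)Y` is, by pure algebra,
  `τ(1−τ)(P₁ − Q₁)(Q₂ − P₂) ≤ τ(X − P₁P₂) + (1−τ)(Y − Q₁Q₂)`: "anti-alignment cross term ≤ unused `Ȳ`-budget + unused
  `H`-budget", where `P₁P₂ ≤ X` and `Q₁Q₂ ≤ Y` are the two face budgets in cap units.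
* **`prod_le_of_tb10`** — the reduction: (RES0′) for an arbitrary family follows from that inequality for its two classes.
Numerically (memo §3–§4, kit j223207) the four-aggregate inequality holds for the section relaxation with the leaf-leaf
constant (n ≤ 8, no exceedance), needs only the budgets {`h`-cell, `Ȳ`-face, `H`-face} + the links `k ≥ g`, `h ≥ g` + the
relation `c₀ ≥ τσ`, and is tight exactly on two-petal configurations; its proof is the lane's next target.
-/

noncomputable section

namespace Summit.CriticalPhenomena.PercolationContinuityZ3.Theorems.SunflowerPartition

namespace SafeCalc

namespace LinkedCurrency

open Finset

variable {κ : Type*}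

/-! ## The cap bound of a class -/

/-- `CB τ a b F = τ ∏_F (1 + a_j/τ) + (1−τ) ∏_F (1 + b_j/(1−τ))`: the expectation, on the two-point space with `P(Y) = τ`,
of the product of the petal functions `(1 + a_j/τ, 1 + b_j/(1−τ))`. [this work] -/
def CB (τ : ℝ) (a b : κ → ℝ) (F : Finset κ) : ℝ :=
  τ * ∏ j ∈ F, (1 + a j / τ) + (1 - τ) * ∏ j ∈ F, (1 + b j / (1 - τ))

/-- Chebyshev for the `H`-heavy class: if `a_j ≥ 0` and `(1−τ) a_j ≤ τ b_j` on `F` then `∏_F (1 + a_j + b_j) ≤ CB τ a b F`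
(`linked_caps` with the two coordinates swapped). [this work] -/
theorem colinked_caps [DecidableEq κ] {τ : ℝ} (hτ0 : 0 < τ) (hτ1 : τ < 1) (a b : κ → ℝ) (F : Finset κ)
    (ha : ∀ j ∈ F, 0 ≤ a j) (hco : ∀ j ∈ F, (1 - τ) * a j ≤ τ * b j) :
    ∏ j ∈ F, (1 + a j + b j) ≤ CB τ a b F := by
  have hτ1' : 0 < 1 - τ := sub_pos.2 hτ1
  have hτ1'' : 1 - τ < 1 := by linarith
  have h := linked_caps hτ1' hτ1'' b a F ha (fun j hj => by rw [sub_sub_cancel]; exact hco j hj)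
  have h1 : ∏ j ∈ F, (1 + b j + a j) = ∏ j ∈ F, (1 + a j + b j) :=
    prod_congr rfl fun j _ => by ring
  rw [h1, sub_sub_cancel] at h
  unfold CB
  linarith

/-- Chebyshev for the `Ȳ`-heavy class (restatement of `linked_caps` with `CB`). [this work] -/
theorem linked_caps' [DecidableEq κ] {τ : ℝ} (hτ0 : 0 < τ) (hτ1 : τ < 1) (a b : κ → ℝ) (F : Finset κ)
    (hb : ∀ j ∈ F, 0 ≤ b j) (hlink : ∀ j ∈ F, τ * b j ≤ (1 - τ) * a j) :
    ∏ j ∈ F, (1 + a j + b j) ≤ CB τ a b F := by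
  unfold CB
  exact linked_caps hτ0 hτ1 a b F hb hlink

/-- `CB` of a class with nonnegative data is at least `1`. [this work] -/
theorem one_le_cb {τ : ℝ} (hτ0 : 0 < τ) (hτ1 : τ < 1) (a b : κ → ℝ) (F : Finset κ)
    (ha : ∀ j ∈ F, 0 ≤ a j) (hb : ∀ j ∈ F, 0 ≤ b j) : 1 ≤ CB τ a b F := by
  have hτ1' : 0 < 1 - τ := sub_pos.2 hτ1
  have h1 : 1 ≤ ∏ j ∈ F, (1 + a j / τ) :=
    one_le_prod fun j hj => by have := div_nonneg (ha j hj) hτ0.le; linarith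
  have h2 : 1 ≤ ∏ j ∈ F, (1 + b j / (1 - τ)) :=
    one_le_prod fun j hj => by have := div_nonneg (hb j hj) hτ1'.le; linarith
  unfold CB
  nlinarith

/-! ## The reduction: any family ≤ CB(Ȳ-heavy class) · CB(H-heavy class) -/

/-- **CHEBYSHEV REDUCTION.**  For `0 < τ < 1` and any finite family with `a_j, b_j ≥ 0`, split by the predicate
`τ b_j ≤ (1−τ) a_j` ("`Ȳ`-heavy"):
`∏_S (1 + a_j + b_j) ≤ CB(S.filter Ȳ-heavy) · CB(S.filter H-heavy)`. [this work] -/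
theorem prod_le_cb_mul_cb [DecidableEq κ] {τ : ℝ} (hτ0 : 0 < τ) (hτ1 : τ < 1) (a b : κ → ℝ) (S : Finset κ)
    (ha : ∀ j ∈ S, 0 ≤ a j) (hb : ∀ j ∈ S, 0 ≤ b j) :
    ∏ j ∈ S, (1 + a j + b j) ≤
      CB τ a b (S.filter fun j => τ * b j ≤ (1 - τ) * a j) *
        CB τ a b (S.filter fun j => ¬ τ * b j ≤ (1 - τ) * a j) := by
  rw [← prod_filter_mul_prod_filter_not S (fun j => τ * b j ≤ (1 - τ) * a j)]
  have hY := linked_caps' hτ0 hτ1 a b (S.filter fun j => τ * b j ≤ (1 - τ) * a j)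
    (fun j hj => hb j (mem_of_mem_filter j hj)) (fun j hj => (mem_filter.1 hj).2)
  have hH := colinked_caps hτ0 hτ1 a b (S.filter fun j => ¬ τ * b j ≤ (1 - τ) * a j)
    (fun j hj => ha j (mem_of_mem_filter j hj))
    (fun j hj => (not_le.1 (mem_filter.1 hj).2).le)
  have h0Y : 0 ≤ ∏ j ∈ S.filter (fun j => τ * b j ≤ (1 - τ) * a j), (1 + a j + b j) :=
    prod_nonneg fun j hj => by
      have := ha j (mem_of_mem_filter j hj); have := hb j (mem_of_mem_filter j hj); linarith
  have h0H : 0 ≤ ∏ j ∈ S.filter (fun j => ¬ τ * b j ≤ (1 - τ) * a j), (1 + a j + b j) :=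
    prod_nonneg fun j hj => by
      have := ha j (mem_of_mem_filter j hj); have := hb j (mem_of_mem_filter j hj); linarith
  exact mul_le_mul hY hH h0H (le_trans h0Y hY)

/-! ## A single class is harmless -/

/-- **One comonotone class.**  If `0 < ε_Y ≤ τ`, `0 < ε_H ≤ 1−τ`, `a_j, b_j ≥ 0` on `F`, and the two face budgets (in value
units) `ε_Y(∏_F(1 + a_j/ε_Y) − 1) ≤ A`, `ε_H(∏_F(1 + b_j/ε_H) − 1) ≤ B` hold, then `CB τ a b F ≤ 1 + A + B`. [this work] -/
theorem cb_le_of_faces [DecidableEq κ] {τ εY εH A B : ℝ} (hεY : 0 < εY)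
    (hεYτ : εY ≤ τ) (hεH : 0 < εH) (hεHτ : εH ≤ 1 - τ) (a b : κ → ℝ) (F : Finset κ)
    (ha : ∀ j ∈ F, 0 ≤ a j) (hb : ∀ j ∈ F, 0 ≤ b j)
    (hfY : εY * (∏ j ∈ F, (1 + a j / εY) - 1) ≤ A) (hfH : εH * (∏ j ∈ F, (1 + b j / εH) - 1) ≤ B) :
    CB τ a b F ≤ 1 + A + B := by
  have h2 := rfun_anti F a ha hεY hεYτ
  have h3 := rfun_anti F b hb hεH hεHτ
  unfold CB
  nlinarith

/-- (RES0′) for an entirely `Ȳ`-heavy (linked) family, from the two face budgets alone. [this work] -/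
theorem prod_le_of_faces_of_linked [DecidableEq κ] {τ εY εH A B : ℝ} (hτ0 : 0 < τ) (hτ1 : τ < 1) (hεY : 0 < εY)
    (hεYτ : εY ≤ τ) (hεH : 0 < εH) (hεHτ : εH ≤ 1 - τ) (a b : κ → ℝ) (F : Finset κ)
    (hb : ∀ j ∈ F, 0 ≤ b j) (hlink : ∀ j ∈ F, τ * b j ≤ (1 - τ) * a j)
    (hfY : εY * (∏ j ∈ F, (1 + a j / εY) - 1) ≤ A) (hfH : εH * (∏ j ∈ F, (1 + b j / εH) - 1) ≤ B) :
    ∏ j ∈ F, (1 + a j + b j) ≤ 1 + A + B := by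
  have ha : ∀ j ∈ F, 0 ≤ a j := fun j hj => by
    have h := hlink j hj
    have h2 : 0 ≤ τ * b j := mul_nonneg hτ0.le (hb j hj)
    nlinarith
  exact (linked_caps' hτ0 hτ1 a b F hb hlink).trans
    (cb_le_of_faces hεY hεYτ hεH hεHτ a b F ha hb hfY hfH)

/-- (RES0′) for an entirely `H`-heavy (co-linked) family, from the two face budgets alone. [this work] -/
theorem prod_le_of_faces_of_colinked [DecidableEq κ] {τ εY εH A B : ℝ} (hτ0 : 0 < τ) (hτ1 : τ < 1)
    (hεY : 0 < εY) (hεYτ : εY ≤ τ) (hεH : 0 < εH) (hεHτ : εH ≤ 1 - τ) (a b : κ → ℝ) (F : Finset κ)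
    (ha : ∀ j ∈ F, 0 ≤ a j) (hco : ∀ j ∈ F, (1 - τ) * a j ≤ τ * b j)
    (hfY : εY * (∏ j ∈ F, (1 + a j / εY) - 1) ≤ A) (hfH : εH * (∏ j ∈ F, (1 + b j / εH) - 1) ≤ B) :
    ∏ j ∈ F, (1 + a j + b j) ≤ 1 + A + B := by
  have hτ1' : 0 < 1 - τ := sub_pos.2 hτ1
  have hb : ∀ j ∈ F, 0 ≤ b j := fun j hj => by
    have h := hco j hj
    have h2 : 0 ≤ (1 - τ) * a j := mul_nonneg hτ1'.le (ha j hj)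
    nlinarith
  exact (colinked_caps hτ0 hτ1 a b F ha hco).trans
    (cb_le_of_faces hεY hεYτ hεH hεHτ a b F ha hb hfY hfH)

/-! ## The four-aggregate inequality and the reduction of (RES0′) to it -/

/-- **The four-aggregate inequality in "cross ≤ unused" form** (pure algebra).  With `P₁,Q₁` the two cap products of the
`Ȳ`-heavy class, `P₂,Q₂` those of the `H`-heavy class, and `X, Y` the two face budgets in cap units:
`(τP₁ + (1−τ)Q₁)(τP₂ + (1−τ)Q₂) ≤ τX + (1−τ)Y  ↔  τ(1−τ)(P₁ − Q₁)(Q₂ − P₂) ≤ τ(X − P₁P₂) + (1−τ)(Y − Q₁Q₂)`. [this work] -/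
theorem tb10_iff (τ P₁ Q₁ P₂ Q₂ X Y : ℝ) :
    (τ * P₁ + (1 - τ) * Q₁) * (τ * P₂ + (1 - τ) * Q₂) ≤ τ * X + (1 - τ) * Y ↔
      τ * (1 - τ) * ((P₁ - Q₁) * (Q₂ - P₂)) ≤ τ * (X - P₁ * P₂) + (1 - τ) * (Y - Q₁ * Q₂) := by
  constructor <;> intro h <;> nlinarith [h]

/-- **REDUCTION OF (RES0′) TO THE FOUR-AGGREGATE INEQUALITY.**  For `0 < τ < 1` and any finite family with
`a_j, b_j ≥ 0`: if the four cap products `P₁ = ∏_{Ȳh}(1 + a_j/τ)`, `Q₁ = ∏_{Ȳh}(1 + b_j/(1−τ))`, `P₂, Q₂` (same over the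
`H`-heavy class) satisfy `τ(1−τ)(P₁ − Q₁)(Q₂ − P₂) ≤ τ(X − P₁P₂) + (1−τ)(Y − Q₁Q₂)`, then
`∏_S (1 + a_j + b_j) ≤ τX + (1−τ)Y`.  (With `X = 1 + A/τ`, `Y = 1 + B/(1−τ)` the right side is `1 + A + B`.) [this work] -/
theorem prod_le_of_tb10 [DecidableEq κ] {τ X Y : ℝ} (hτ0 : 0 < τ) (hτ1 : τ < 1) (a b : κ → ℝ) (S : Finset κ)
    (ha : ∀ j ∈ S, 0 ≤ a j) (hb : ∀ j ∈ S, 0 ≤ b j)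
    (h : τ * (1 - τ) *
        ((∏ j ∈ S.filter (fun j => τ * b j ≤ (1 - τ) * a j), (1 + a j / τ) -
            ∏ j ∈ S.filter (fun j => τ * b j ≤ (1 - τ) * a j), (1 + b j / (1 - τ))) *
          (∏ j ∈ S.filter (fun j => ¬ τ * b j ≤ (1 - τ) * a j), (1 + b j / (1 - τ)) -
            ∏ j ∈ S.filter (fun j => ¬ τ * b j ≤ (1 - τ) * a j), (1 + a j / τ))) ≤
      τ * (X - (∏ j ∈ S.filter (fun j => τ * b j ≤ (1 - τ) * a j), (1 + a j / τ)) *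
          ∏ j ∈ S.filter (fun j => ¬ τ * b j ≤ (1 - τ) * a j), (1 + a j / τ)) +
        (1 - τ) * (Y - (∏ j ∈ S.filter (fun j => τ * b j ≤ (1 - τ) * a j), (1 + b j / (1 - τ))) *
          ∏ j ∈ S.filter (fun j => ¬ τ * b j ≤ (1 - τ) * a j), (1 + b j / (1 - τ)))) :
    ∏ j ∈ S, (1 + a j + b j) ≤ τ * X + (1 - τ) * Y := by
  have h1 := prod_le_cb_mul_cb hτ0 hτ1 a b S ha hb
  have h2 := (tb10_iff τ _ _ _ _ X Y).2 h
  unfold CB at h1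
  exact h1.trans h2

/-- The target in cap units: `τ(1 + A/τ) + (1−τ)(1 + B/(1−τ)) = 1 + A + B`. [this work] -/
theorem caps_target {τ : ℝ} (hτ0 : 0 < τ) (hτ1 : τ < 1) (A B : ℝ) :
    τ * (1 + A / τ) + (1 - τ) * (1 + B / (1 - τ)) = 1 + A + B := by
  have hτ1' : (1 - τ) ≠ 0 := (sub_pos.2 hτ1).ne'
  field_simp
  ring

end LinkedCurrency

end SafeCalc

end Summit.CriticalPhenomena.PercolationContinuityZ3.Theorems.SunflowerPartition
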